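import Mathlib
import Literature.Probability.LatticeModels.AxisSpectralRepresentationProofs
import Literature.Probability.LatticeModels.CriticalTwoPointBounds
import Literature.Probability.LatticeModels.CriticalTwoPointLower

/-!
# Crux `CriticalTwoPointGSM` (stmt-CriticalPhenomena-8365), line `Sketch` (canonical-lift spine,
seat c1) — stub `js_noAtom`: no spectral mass at `λ = 0`

Write a site of `ℤ³` as `Fin.cons n z` (`n ∈ ℤ` the reflection-positive axis, `z ∈ ℤ²` transverse)
and a point of the spectral side as `p : Fin 3 → ℝ`, `p 0 = λ`, `(p 1, p 2) = k`. A *joint spectral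
measure* of the critical two-point function of the nearest-neighbour Ising model on `ℤ³` is a
probability measure `ρ` on `ℝ³` carried by the box `[0,1]×[-π,π]²` with
`⟨σ₀σ_{(n,z)}⟩⁺_{β_c} = ∫ λ^{|n|} cos(k·z) dρ` for all `n ∈ ℤ`, `z ∈ ℤ²`.

**Theorem `js_noAtom`.** Given the determinacy of the Hausdorff moment problem on `[0,1]`
(hypothesis `hdet`, the statement of the neighbouring stub `js_momentDeterminacy`), every joint
spectral measure `ρ` has `ρ {λ ≤ 0} = 0`.

*Proof.* The `λ`-marginal `ρ₁ := ρ ∘ (p ↦ p 0)⁻¹` is a finite measure carried by `[0,1]` whose moments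
are the axis values `∫ tⁿ dρ₁ = ⟨σ₀σ_{n e₀}⟩⁺_{β_c}` (the representation at `z = 0`). By
Aizenman–Duminil-Copin 2021, Prop. 8.6 (`AizenmanDuminilCopin2021_prop_8_6_holds`, the Laplace form of
the axis two-point function, at `d = 2+1`, `β = β_c(3) > 0` by `criticalBeta_pos_holds`,
`m*(β_c(3)) = 0` by `spontaneousMagnetization_criticalBeta_eq_zero_holds`) there is a finite measure
`μ` carried by `[0,∞)` with `⟨σ₀σ_{n e₀}⟩⁺_{β_c} = ∫ e^{-a|n|} dμ`; its image `μ'` under `a ↦ e^{-a}`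
is carried by `(0,1]` and has the same moments. Determinacy gives `ρ₁ = μ'`, whence
`ρ {λ ≤ 0} = ρ₁ (-∞,0] = μ' (-∞,0] = μ {a | e^{-a} ≤ 0} = μ ∅ = 0`.
-/

namespace Summit.CriticalPhenomena.Ising3DConformalLimit.Theorems

open MeasureTheory Filter Topology
open Literature.Probability.LatticeModels
open scoped BigOperators

noncomputable section

namespace CriticalTwoPointGSMJs.JsNoAtom

/-- The axis site `(n, 0, 0)` written as `Fin.cons` is the coordinate vector `n e₀`. -/
theorem cons_zero_eq_single (n : ℤ) :
    (Fin.cons n (0 : Fin 2 → ℤ) : Fin 3 → ℤ) = Pi.single (0 : Fin 3) n := by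
  funext i
  refine Fin.cases ?_ (fun j => ?_) i
  · simp only [Fin.cons_zero, Pi.single_eq_same]
  · simp only [Fin.cons_succ, Pi.zero_apply, Pi.single_eq_of_ne (Fin.succ_ne_zero j)]

/-- The axis moments of a joint spectral measure: `∫ (p 0)ⁿ dρ = ⟨σ₀σ_{n e₀}⟩⁺_{β_c}` (the joint
representation at transverse separation `z = 0`, where the kernel is `λ^{|n|} cos 0 = λⁿ`). -/
theorem axisMoment_eq (ρ : Measure (Fin 3 → ℝ))
    (hrep : ∀ (n : ℤ) (z : Fin 2 → ℤ), criticalTwoPoint 3 (Fin.cons n z) =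
      ∫ p, (p 0) ^ n.natAbs * Real.cos (∑ j : Fin 2, p j.succ * (z j : ℝ)) ∂ρ) (n : ℕ) :
    ∫ p, (p 0) ^ n ∂ρ = criticalTwoPoint 3 (Pi.single (0 : Fin 3) (n : ℤ)) := by
  rw [← cons_zero_eq_single, hrep (n : ℤ) 0]
  refine integral_congr_ae (Eventually.of_forall fun p => ?_)
  simp only [Int.natAbs_natCast, Pi.zero_apply, Int.cast_zero, mul_zero, Finset.sum_const_zero,
    Real.cos_zero, mul_one]

/-- The `λ`-marginal `ρ ∘ (p ↦ p 0)⁻¹` of a probability measure carried by the box `[0,1]×[-π,π]²`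
is carried by `[0,1]`. -/
theorem marginal_compl_Icc_eq_zero (ρ : Measure (Fin 3 → ℝ))
    (hsupp : ρ {p | 0 ≤ p 0 ∧ p 0 ≤ 1 ∧ ∀ j : Fin 2, -Real.pi ≤ p j.succ ∧ p j.succ ≤ Real.pi}ᶜ = 0) :
    (ρ.map fun p : Fin 3 → ℝ => p 0) (Set.Icc (0 : ℝ) 1)ᶜ = 0 := by
  rw [Measure.map_apply (measurable_pi_apply 0) measurableSet_Icc.compl]
  refine measure_mono_null (fun p hp => ?_) hsupp
  simp only [Set.mem_preimage, Set.mem_compl_iff, Set.mem_Icc, not_and, not_le,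
    Set.mem_setOf_eq] at hp ⊢
  intro h0 h1
  exact absurd (hp h0) (not_lt.mpr h1)

/-- **The Laplace-form measure of the critical axis, pushed to `(0,1]`.** From
Aizenman–Duminil-Copin 2021 Prop. 8.6 at `d = 2+1`, `β = β_c(3)`, axis `e₀`: there is a finite
measure `μ'` on `ℝ`, carried by `[0,1]`, giving NO mass to `(-∞, 0]`, whose moments are the critical
axis two-point function, `∫ tⁿ dμ' = ⟨σ₀σ_{n e₀}⟩⁺_{β_c}` (`μ'` is the image under `a ↦ e^{-a}` of
the Laplace-form measure `μ` on `[0,∞)`). -/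
theorem exists_axisHausdorffMeasure_noAtom :
    ∃ μ' : Measure ℝ, IsFiniteMeasure μ' ∧ μ' (Set.Icc (0 : ℝ) 1)ᶜ = 0 ∧ μ' (Set.Iic (0 : ℝ)) = 0 ∧
      ∀ n : ℕ, ∫ t, t ^ n ∂μ' = criticalTwoPoint 3 (Pi.single (0 : Fin 3) (n : ℤ)) := by
  have hβ : 0 < criticalBeta (2 + 1) := criticalBeta_pos_holds (d := 2 + 1) (by norm_num)
  have hm : spontaneousMagnetization (2 + 1) (criticalBeta (2 + 1)) = 0 :=
    spontaneousMagnetization_criticalBeta_eq_zero_holds (d := 2 + 1) (by norm_num)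
  obtain ⟨μ, hfin, hsupp, hrep⟩ := AizenmanDuminilCopin2021_prop_8_6_holds 2 (criticalBeta (2 + 1)) hβ hm 0
  have hf : Measurable fun a : ℝ => Real.exp (-a) := Real.measurable_exp.comp measurable_neg
  refine ⟨μ.map fun a => Real.exp (-a), inferInstance, ?_, ?_, fun n => ?_⟩
  · -- carried by `[0,1]`: `a ≥ 0 ⇒ e^{-a} ∈ (0,1]`
    rw [Measure.map_apply hf measurableSet_Icc.compl]
    refine measure_mono_null (fun a ha => ?_) hsupp
    simp only [Set.mem_preimage, Set.mem_compl_iff, Set.mem_Icc, not_and, not_le, Set.mem_Ici] at ha ⊢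
    have hpos : (0 : ℝ) ≤ Real.exp (-a) := (Real.exp_pos _).le
    have h1 : 1 < Real.exp (-a) := ha hpos
    have : 0 < -a := by
      by_contra hle
      have := Real.exp_le_one_iff.mpr (not_lt.mp hle)
      linarith
    linarith
  · -- no mass on `(-∞, 0]`: `e^{-a} > 0`
    rw [Measure.map_apply hf measurableSet_Iic]
    have hempty : (fun a : ℝ => Real.exp (-a)) ⁻¹' Set.Iic (0 : ℝ) = ∅ := by
      ext a
      simp only [Set.mem_preimage, Set.mem_Iic, Set.mem_empty_iff_false, iff_false, not_le]
      exact Real.exp_pos _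
    rw [hempty, measure_empty]
  · -- moments: `∫ (e^{-a})ⁿ dμ = ∫ e^{-a n} dμ = ⟨σ₀σ_{n e₀}⟩⁺_{β_c}`
    have h3 : criticalTwoPoint 3 (Pi.single (0 : Fin 3) (n : ℤ)) =
        twoPointPlus (2 + 1) (criticalBeta (2 + 1)) (Pi.single (0 : Fin (2 + 1)) (n : ℤ)) := rfl
    rw [h3, integral_map hf.aemeasurable (continuous_pow n).aestronglyMeasurable, hrep n]
    refine integral_congr_ae (Eventually.of_forall fun a => ?_)
    simp only [Int.cast_natCast, Nat.abs_cast]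
    rw [← Real.exp_nat_mul]
    ring_nf

end CriticalTwoPointGSMJs.JsNoAtom

open CriticalTwoPointGSMJs.JsNoAtom in
/-- **Stub `js_noAtom` (no spectral mass at `λ = 0`), line `Sketch` (canonical-lift spine) of crux
`CriticalTwoPointGSM`.** Given the determinacy of the Hausdorff moment problem on `[0,1]` (`hdet`),
every joint spectral measure `ρ` of the critical two-point function of the nearest-neighbour Ising
model on `ℤ³` — a probability measure on `ℝ³` carried by `[0,1]×[-π,π]²` with
`⟨σ₀σ_{(n,z)}⟩⁺_{β_c} = ∫ λ^{|n|} cos(k·z) dρ` — gives no mass to `{λ ≤ 0}`: its `λ`-marginal has the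
axis moments `⟨σ₀σ_{n e₀}⟩⁺_{β_c} = ∫ e^{-a|n|} dμ(a)` with `μ` carried by `[0,∞)`
(Aizenman–Duminil-Copin 2021 Prop. 8.6, `AizenmanDuminilCopin2021_prop_8_6_holds`), hence equals
the image of `μ` under `a ↦ e^{-a}`, which lives on `(0,1]`. -/
theorem js_noAtom
    (hdet : ∀ μ₁ μ₂ : Measure ℝ, IsFiniteMeasure μ₁ → IsFiniteMeasure μ₂ →
      μ₁ (Set.Icc (0 : ℝ) 1)ᶜ = 0 → μ₂ (Set.Icc (0 : ℝ) 1)ᶜ = 0 →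
      (∀ n : ℕ, ∫ t, t ^ n ∂μ₁ = ∫ t, t ^ n ∂μ₂) → μ₁ = μ₂) :
    ∀ ρ : Measure (Fin 3 → ℝ), IsProbabilityMeasure ρ →
      ρ {p | 0 ≤ p 0 ∧ p 0 ≤ 1 ∧ ∀ j : Fin 2, -Real.pi ≤ p j.succ ∧ p j.succ ≤ Real.pi}ᶜ = 0 →
      (∀ (n : ℤ) (z : Fin 2 → ℤ), criticalTwoPoint 3 (Fin.cons n z) =
        ∫ p, (p 0) ^ n.natAbs * Real.cos (∑ j : Fin 2, p j.succ * (z j : ℝ)) ∂ρ) →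
      ρ {p | p 0 ≤ 0} = 0 := by
  intro ρ hρ hsupp hrep
  -- the `λ`-marginal
  have hmeas : Measurable fun p : Fin 3 → ℝ => p 0 := measurable_pi_apply 0
  set ρ₁ : Measure ℝ := ρ.map fun p : Fin 3 → ℝ => p 0 with hρ₁
  haveI : IsProbabilityMeasure ρ₁ := Measure.isProbabilityMeasure_map hmeas.aemeasurable
  have hsupp₁ : ρ₁ (Set.Icc (0 : ℝ) 1)ᶜ = 0 := marginal_compl_Icc_eq_zero ρ hsupp
  have hmom₁ : ∀ n : ℕ, ∫ t, t ^ n ∂ρ₁ = criticalTwoPoint 3 (Pi.single (0 : Fin 3) (n : ℤ)) := by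
    intro n
    rw [hρ₁, integral_map hmeas.aemeasurable (continuous_pow n).aestronglyMeasurable]
    exact axisMoment_eq ρ hrep n
  -- the Laplace-form measure of the axis, pushed to `(0,1]`
  obtain ⟨μ', hfin', hsupp', hnoatom', hmom'⟩ := exists_axisHausdorffMeasure_noAtom
  -- determinacy identifies the two
  have heq : ρ₁ = μ' := hdet ρ₁ μ' inferInstance hfin' hsupp₁ hsupp'
    (fun n => by rw [hmom₁ n, hmom' n])
  -- transport the absence of mass at `λ ≤ 0`
  have hset : {p : Fin 3 → ℝ | p 0 ≤ 0} = (fun p : Fin 3 → ℝ => p 0) ⁻¹' Set.Iic (0 : ℝ) := rfl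
  rw [hset, ← Measure.map_apply hmeas measurableSet_Iic, ← hρ₁, heq, hnoatom']

end

end Summit.CriticalPhenomena.Ising3DConformalLimit.Theorems
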